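import Literature.AlgebraicGeometry.AbelianSchemes.RigidifiedLineBundleLimitDescentStage
import Literature.AlgebraicGeometry.AbelianVarieties.RigidifiedLineBundlePicZeroLocusClosed
import Mathlib.AlgebraicGeometry.Morphisms.FinitePresentation
import HarnessLib

/-!
# `∃!` classifying maps over ALL affine test schemes from the affine test schemes of finite type

Topic: `Literature/AlgebraicGeometry/AbelianVarieties`. Mumford's reduction «it suffices to consider `T` of finite type»
in the proof of [MumfordAV1970] §13, by Noetherian approximation `Spec R = lim Spec K[t]` ([EGAIV3] 8.5.2 / 8.8.2,
[GortzWedhorn2020] Thm. 10.57 / 10.60, The Stacks Project 01ZC / 0B8W / 01ZR): for abelian schemes `A`, `B` over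
`Spec K` and a rank-one `𝒫` on `A ×_K B`, the `∃!` of classifying maps for rigidified fibrewise-`Pic⁰` line bundles on
`A_T`, `T` AFFINE, follows from the same over the affine `T` OF FINITE TYPE (`existsUnique_classify_specOver`,
`existsUnique_classify_affine_of_finiteType`), modulo the closedness of the `Pic⁰` locus over affine finite-type bases
— which holds for `A = A₀ × Spec K` (★ `isClosed_picZeroLocus`, B-p17): `existsUnique_classify_affine_of_finiteType_ofAbelianVariety`.
EXISTENCE: ★ `AbelianSchemes/RigidifiedLineBundleLimitDescentStage` + restriction; UNIQUENESS: a second classifying map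
factors through a stage (Stacks 01ZC, Mathlib `Scheme.exists_π_app_comp_eq_of_locallyOfFinitePresentation`), the two
isomorphisms agree on the limit hence at a deeper stage (★ `exists_stage_iso_of_pullback_iso`), where finite-type
uniqueness applies. Everything is proved; theorems only; no named facts.

## References
* [MumfordAV1970] D. Mumford, *Abelian Varieties* (1970), §13 (Thm. p. 125 and its proof).
* [StacksProject] The Stacks Project, Tags 01ZC, 0B8W, 01ZR.
* [GortzWedhorn2020] U. Görtz, T. Wedhorn, *Algebraic Geometry I*, 2nd ed. (2020), Thm. 10.57, Thm. 10.60.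
* [EGAIV3] A. Grothendieck, J. Dieudonné, EGA IV₃ (1966), Thm. 8.8.2.
* [MilneAV2008] J. S. Milne, *Abelian Varieties* (2008), I §8 pp. 36–37.
-/

universe u

open CategoryTheory CategoryTheory.Limits AlgebraicGeometry MonoidalCategory

namespace Literature.AlgebraicGeometry.AbelianSchemes

open Literature.AlgebraicGeometry.Motives Literature.AlgebraicGeometry.AbelianVarieties
  Literature.AlgebraicGeometry.Modules Literature.AlgebraicGeometry.Limits
  Literature.AlgebraicGeometry.Limits.SubalgApprox

set_option backward.isDefEq.respectTransparency false

namespace AbelianSchemeOver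

section LimitDescent

variable {K : Type u} [Field K] (A B : AbelianSchemeOver (Spec (.of K))) (P : (A.prodLeft B).Modules)
  (R : Type u) [CommRing R] [Algebra K R]

/-! ### §1 The structure maps of the base diagram, as a natural transformation (for Stacks 01ZC) -/

/-- The structure maps `Spec K[t] → Spec K` of the base diagram commute with its transition maps (a
projective system of `K`-schemes, Görtz–Wedhorn I (10.13) 1.). [cite: GortzWedhorn2020, (10.13) (pp. 261–262)] -/
theorem baseDiagram_structure_naturality (s₁ : Finset R) {t t' : (Idx R s₁)ᵒᵖ} (φ : t ⟶ t') :
    (baseDiagram K R s₁ ⋙ Over.forget _).map φ ≫ ((baseDiagram K R s₁).obj t').hom =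
      ((baseDiagram K R s₁).obj t).hom ≫ ((Functor.const (Idx R s₁)ᵒᵖ).obj (Spec (.of K))).map φ := by
  change ((baseDiagram K R s₁).map φ).left ≫ _ = _ ≫ 𝟙 _
  rw [Over.w, Category.comp_id]

/-! ### §2 THE LIMIT DESCENT over `Spec R` -/

variable {A B P R} in
/-- **`∃!` classifying map for a rigidified fibrewise-`Pic⁰` line bundle on `A_{Spec R}`, `R` ANY `K`-algebra, from
the same statement over the affine `K`-schemes OF FINITE TYPE** (Mumford's reduction «it suffices to consider `T` of
finite type» in the proof of [MumfordAV1970] §13, by Noetherian approximation `Spec R = lim Spec K[t]`,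
[EGAIV3] 8.5.2 / 8.8.2, [GortzWedhorn2020] Thm. 10.57 / 10.60): EXISTENCE — descend `(ℒ, ε^*ℒ ≅ 𝒪)` to a rigidified
line bundle on some `A_{Spec K[t]}` (`exists_stage_rigidifiedLineBundle`), fibrewise in `Pic⁰` by the closedness of
the `Pic⁰` locus and the dominance of `Spec R → Spec K[t]` (`fibrewisePicZero_stage`), classify it there and restrict;
UNIQUENESS — a second classifying map factors through a stage (Stacks 01ZC, Mathlib
`Scheme.exists_π_app_comp_eq_of_locallyOfFinitePresentation`), the two isomorphisms with `𝒫` pulled back agree on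
the limit hence on a deeper stage (`exists_stage_iso_of_pullback_iso`), where finite-type uniqueness applies.
[cite: MumfordAV1970, §13 (proof of the Thm. p. 125)] [cite: StacksProject, Tag 01ZC and Tag 0B8W] [cite: GortzWedhorn2020, Thm. 10.57 and Thm. 10.60] -/
theorem existsUnique_classify_specOver (hP : HasRank P 1)
    (hclosed : ∀ (T : Scheme.{u}) [IsAffine T] (f : T ⟶ Spec (.of K)) [LocallyOfFiniteType f]
      (ℒ : A.RigidifiedLineBundle f), IsClosed ℒ.picZeroLocus)
    (haff_ft : ∀ (T' : Scheme.{u}) [IsAffine T'] (f' : T' ⟶ Spec (.of K)) [LocallyOfFiniteType f']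
      (ℒ' : A.RigidifiedLineBundle f'), ℒ'.FibrewisePicZero →
      ∃! g : {g : T' ⟶ B.X.left // g ≫ B.X.hom = f'},
        Nonempty ((Scheme.Modules.pullback (A.baseChangeToProd B f' g.1 g.2)).obj P ≅ ℒ'.L))
    (ℒ : A.RigidifiedLineBundle (specOver K R).hom) (hℒ : ℒ.FibrewisePicZero) :
    ∃! g : {g : (specOver K R).left ⟶ B.X.left // g ≫ B.X.hom = (specOver K R).hom},
      Nonempty ((Scheme.Modules.pullback (A.baseChangeToProd B (specOver K R).hom g.1 g.2)).obj P ≅ ℒ.L) := by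
  classical
  haveI := A.isProper
  haveI := A.isSmooth
  haveI := B.isSmooth
  haveI : ∀ t₁ : (Idx R (∅ : Finset R))ᵒᵖ, LocallyOfFiniteType ((baseDiagram K R ∅).obj t₁).hom :=
    fun t₁ => locallyOfFiniteType_baseDiagram_obj_hom R ∅ t₁
  -- shorthand for the base diagram
  let Db : (Idx R (∅ : Finset R))ᵒᵖ ⥤ Scheme.{u} := baseDiagram K R ∅ ⋙ Over.forget _
  let cb : Cone Db := (Over.forget _).mapCone (baseCone K R ∅)
  have hcb : IsLimit cb := isLimitForgetBaseCone K R ∅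
  -- the base diagram is a cofiltered system of qcqs schemes with affine transition maps (§2 of the stage file)
  haveI : ∀ {t t' : (Idx R (∅ : Finset R))ᵒᵖ} (φ : t ⟶ t'), IsAffineHom (Db.map φ) :=
    fun φ => isAffineHom_baseDiagram_forget_map (K := K) R ∅ φ
  haveI : ∀ t : (Idx R (∅ : Finset R))ᵒᵖ, CompactSpace (Db.obj t) :=
    fun t => compactSpace_baseDiagram_forget_obj (K := K) R ∅ t
  haveI : ∀ t : (Idx R (∅ : Finset R))ᵒᵖ, QuasiSeparatedSpace (Db.obj t) :=
    fun t => quasiSeparatedSpace_baseDiagram_forget_obj (K := K) R ∅ t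
  let T_ : (Idx R (∅ : Finset R))ᵒᵖ → SchemeOver K := fun t => (baseDiagram K R ∅).obj t
  let w_ : ∀ t, (specOver K R).left ⟶ (T_ t).left := fun t => ((baseCone K R ∅).π.app t).left
  have hw_ : ∀ t, w_ t ≫ (T_ t).hom = (specOver K R).hom := fun t => Over.w _
  let m_ : ∀ {t t'} (φ : t ⟶ t'), (T_ t).left ⟶ (T_ t').left := fun φ => ((baseDiagram K R ∅).map φ).left
  have hm_ : ∀ {t t'} (φ : t ⟶ t'), m_ φ ≫ (T_ t').hom = (T_ t).hom := fun φ => Over.w _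
  have hwm : ∀ {t t'} (φ : t ⟶ t'), w_ t ≫ m_ φ = w_ t' := fun φ => by
    simp only [w_, m_]; rw [← Over.comp_left, (baseCone K R ∅).w φ]
  -- EXISTENCE: descend, check `Pic⁰`, classify at the stage, restrict
  obtain ⟨t, ℒt, ⟨e⟩⟩ := A.exists_stage_rigidifiedLineBundle ℒ
  have hℒt : ℒt.FibrewisePicZero := A.fibrewisePicZero_stage hclosed ℒ hℒ ℒt e
  obtain ⟨⟨gt, hgt⟩, ⟨et⟩, -⟩ := haff_ft (T_ t).left (T_ t).hom ℒt hℒt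
  have hg : (w_ t ≫ gt) ≫ B.X.hom = (specOver K R).hom := by rw [Category.assoc, hgt, hw_]
  -- the junction `π_t = 1_A × w_t` as an equality of pull-back functors' values
  have eπ : ∀ (t : (Idx R (∅ : Finset R))ᵒᵖ) (M : ((prodDiagram K R ∅ A.X).obj t).Modules),
      (Scheme.Modules.pullback ((prodCone K R ∅ A.X).π.app t)).obj M =
        (Scheme.Modules.pullback (A.prodMap (specOver K R).hom (T_ t).hom (w_ t) (hw_ t))).obj M :=
    fun t M => by rw [A.prodCone_π_app_eq_prodMap R ∅ t]
  have eg : Nonempty ((Scheme.Modules.pullback (A.baseChangeToProd B (specOver K R).hom (w_ t ≫ gt) hg)).obj P ≅ ℒ.L) :=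
    ⟨A.restrictSolutionIso B P (w_ t) (hw_ t) hgt et ≪≫ eqToIso (eπ t ℒt.L).symm ≪≫ e.symm⟩
  refine ⟨⟨w_ t ≫ gt, hg⟩, eg, ?_⟩
  -- UNIQUENESS
  rintro ⟨g₂, hg₂⟩ ⟨e₂⟩
  apply Subtype.ext
  change g₂ = w_ t ≫ gt
  -- (U1) `g₂` factors through a stage `s`
  let τ : Db ⟶ (Functor.const (Idx R (∅ : Finset R))ᵒᵖ).obj (Spec (.of K)) :=
    { app := fun t => (T_ t).hom
      naturality := fun t t' φ => baseDiagram_structure_naturality (K := K) R ∅ φ }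
  have hτ : cb.π ≫ τ = (Functor.const _).map (g₂ ≫ B.X.hom) := by
    ext t'
    change w_ t' ≫ (T_ t').hom = g₂ ≫ B.X.hom
    rw [hw_, hg₂]
  obtain ⟨s, g₂s, hfac, hg₂s⟩ := Scheme.exists_π_app_comp_eq_of_locallyOfFinitePresentation Db τ B.X.hom cb hcb
    g₂ hτ
  change w_ s ≫ g₂s = g₂ at hfac
  change g₂s ≫ B.X.hom = (T_ s).hom at hg₂s
  -- (U2) a common refinement `u` of `t` and `s`; the data there
  obtain ⟨u, ⟨φt⟩, ⟨φs⟩⟩ := exists_hom₂ R (∅ : Finset R) t s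
  let ℒu : A.RigidifiedLineBundle (T_ u).hom := ℒt.comapAlong (m_ φt) (hm_ φt)
  have hℒu : ℒu.FibrewisePicZero := RigidifiedLineBundle.comapAlong_fibrewisePicZero hℒt _ _
  have hg₁u : (m_ φt ≫ gt) ≫ B.X.hom = (T_ u).hom := by rw [Category.assoc, hgt, hm_]
  have hg₂u : (m_ φs ≫ g₂s) ≫ B.X.hom = (T_ u).hom := by rw [Category.assoc, hg₂s, hm_]
  -- the junction `D φ = 1_A × m_φ` as an equality of pull-back values
  have eD : ∀ {t t' : (Idx R (∅ : Finset R))ᵒᵖ} (φ : t ⟶ t') (M : ((prodDiagram K R ∅ A.X).obj t').Modules),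
      (Scheme.Modules.pullback ((prodDiagram K R ∅ A.X).map φ)).obj M =
        (Scheme.Modules.pullback (A.prodMap (T_ t).hom (T_ t').hom (m_ φ) (hm_ φ))).obj M :=
    fun φ M => by rw [A.prodDiagram_map_eq_prodMap R ∅ φ]
  -- (U3) the two modules at stage `u` become isomorphic on the limit, hence at a deeper stage `v`
  let M₁ : ((prodDiagram K R ∅ A.X).obj u).Modules :=
    (Scheme.Modules.pullback (A.baseChangeToProd B (T_ u).hom (m_ φs ≫ g₂s) hg₂u)).obj P
  have hw₂ : (w_ u ≫ m_ φs ≫ g₂s) = g₂ := by rw [← Category.assoc, hwm, hfac]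
  have Φ : (Scheme.Modules.pullback ((prodCone K R ∅ A.X).π.app u)).obj M₁ ≅
      (Scheme.Modules.pullback ((prodCone K R ∅ A.X).π.app u)).obj ℒu.L :=
    eqToIso (eπ u M₁) ≪≫ (A.restrictSolutionIso B P (w_ u) (hw_ u) hg₂u (Iso.refl M₁)).symm ≪≫
      (Scheme.Modules.pullbackCongr (A.baseChangeToProd_congr B _ hw₂ _ hg₂)).app P ≪≫ e₂ ≪≫ e ≪≫
      (Scheme.Modules.pullbackCongr ((prodCone K R ∅ A.X).w φt).symm).app ℒt.L ≪≫
      ((Scheme.Modules.pullbackComp _ _).app ℒt.L).symm ≪≫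
      (Scheme.Modules.pullback _).mapIso (eqToIso (eD φt ℒt.L))
  obtain ⟨v, φv, ⟨Ψ⟩⟩ := FiniteLocallyFreeIsoDescent.exists_stage_iso_of_pullback_iso
    (prodDiagram K R ∅ A.X) (prodCone K R ∅ A.X) (isLimitProdCone K R ∅ A.X) (i := u)
    (HasRank.isFiniteLocallyFree' (hasRank_pullback _ hP)) (HasRank.isFiniteLocallyFree' ℒu.hasRank_one) Φ
  -- (U4) at stage `v` both maps classify `ℒv`, so they agree by finite-type uniqueness
  let ℒv : A.RigidifiedLineBundle (T_ v).hom := ℒu.comapAlong (m_ φv) (hm_ φv)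
  have hℒv : ℒv.FibrewisePicZero := RigidifiedLineBundle.comapAlong_fibrewisePicZero hℒu _ _
  have hg₁v : (m_ φv ≫ m_ φt ≫ gt) ≫ B.X.hom = (T_ v).hom := by rw [Category.assoc, hg₁u, hm_]
  have hg₂v : (m_ φv ≫ m_ φs ≫ g₂s) ≫ B.X.hom = (T_ v).hom := by rw [Category.assoc, hg₂u, hm_]
  have e₁v : Nonempty ((Scheme.Modules.pullback (A.baseChangeToProd B (T_ v).hom (m_ φv ≫ m_ φt ≫ gt) hg₁v)).obj P ≅
      ℒv.L) :=
    ⟨A.restrictSolutionIso B P (m_ φv) (hm_ φv) hg₁u (A.restrictSolutionIso B P (m_ φt) (hm_ φt) hgt et)⟩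
  have e₂v : Nonempty ((Scheme.Modules.pullback (A.baseChangeToProd B (T_ v).hom (m_ φv ≫ m_ φs ≫ g₂s) hg₂v)).obj P ≅
      ℒv.L) :=
    ⟨A.restrictSolutionIso B P (m_ φv) (hm_ φv) hg₂u (Iso.refl M₁) ≪≫ eqToIso (eD φv M₁).symm ≪≫ Ψ ≪≫
      eqToIso (eD φv ℒu.L)⟩
  have huv := (haff_ft (T_ v).left (T_ v).hom ℒv hℒv).unique (y₁ := ⟨_, hg₁v⟩) (y₂ := ⟨_, hg₂v⟩) e₁v e₂v
  have huv' : m_ φv ≫ m_ φt ≫ gt = m_ φv ≫ m_ φs ≫ g₂s := congrArg Subtype.val huv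
  -- (U5) compose with the leg `Spec R → Spec K[v]`
  calc g₂ = w_ u ≫ m_ φs ≫ g₂s := hw₂.symm
    _ = (w_ v ≫ m_ φv) ≫ m_ φs ≫ g₂s := by rw [hwm]
    _ = w_ v ≫ (m_ φv ≫ m_ φt ≫ gt) := by rw [Category.assoc, huv']
    _ = (w_ v ≫ m_ φv) ≫ m_ φt ≫ gt := by rw [Category.assoc]
    _ = w_ t ≫ gt := by rw [hwm, ← Category.assoc, hwm]


/-! ### §3 Transport along an isomorphism of test schemes; every affine `T` over `Spec K` is a `Spec R` -/

variable {A B P} in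
/-- **`∃!` is invariant under an isomorphism of test schemes over `S`.** [cite: MilneAV2008, I §8 pp. 36–37] -/
theorem existsUnique_classify_of_iso {S : Scheme.{u}} {A B : AbelianSchemeOver S} (P : (A.prodLeft B).Modules)
    {T₁ T₂ : Scheme.{u}} {f₁ : T₁ ⟶ S} {f₂ : T₂ ⟶ S} (w : T₁ ≅ T₂) (hw : w.hom ≫ f₂ = f₁)
    (h : ∀ (ℒ : A.RigidifiedLineBundle f₂), ℒ.FibrewisePicZero →
      ∃! g : {g : T₂ ⟶ B.X.left // g ≫ B.X.hom = f₂},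
        Nonempty ((Scheme.Modules.pullback (A.baseChangeToProd B f₂ g.1 g.2)).obj P ≅ ℒ.L))
    (ℒ : A.RigidifiedLineBundle f₁) (hℒ : ℒ.FibrewisePicZero) :
    ∃! g : {g : T₁ ⟶ B.X.left // g ≫ B.X.hom = f₁},
      Nonempty ((Scheme.Modules.pullback (A.baseChangeToProd B f₁ g.1 g.2)).obj P ≅ ℒ.L) := by
  have hw' : w.inv ≫ f₁ = f₂ := by rw [← hw, w.inv_hom_id_assoc]
  -- transport the datum to `T₂`
  let ℒ₂ : A.RigidifiedLineBundle f₂ := ℒ.comapAlong w.inv hw'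
  have hℒ₂ : ℒ₂.FibrewisePicZero := RigidifiedLineBundle.comapAlong_fibrewisePicZero hℒ _ _
  obtain ⟨⟨g₂, hg₂⟩, ⟨e₂⟩, huniq⟩ := h ℒ₂ hℒ₂
  -- `(1 × w.hom)^* (1 × w.inv)^* ℒ = ℒ`
  have back : (Scheme.Modules.pullback (A.prodMap f₁ f₂ w.hom hw)).obj ℒ₂.L ≅ ℒ.L :=
    (Scheme.Modules.pullbackComp _ _).app ℒ.L ≪≫
      (Scheme.Modules.pullbackCongr (by
        rw [prodMap_comp]
        exact (A.prodMap_congr f₁ f₁ w.hom_inv_id _ _).trans (A.prodMap_id f₁ (Category.id_comp f₁)))).app ℒ.L ≪≫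
      (Scheme.Modules.pullbackId _).app ℒ.L
  have hg : (w.hom ≫ g₂) ≫ B.X.hom = f₁ := by rw [Category.assoc, hg₂, hw]
  refine ⟨⟨w.hom ≫ g₂, hg⟩, ⟨A.restrictSolutionIso B P w.hom hw hg₂ e₂ ≪≫ back⟩, ?_⟩
  rintro ⟨g', hg'⟩ ⟨e'⟩
  apply Subtype.ext
  change g' = w.hom ≫ g₂
  have hg'' : (w.inv ≫ g') ≫ B.X.hom = f₂ := by rw [Category.assoc, hg', hw']
  have h₂ := huniq ⟨w.inv ≫ g', hg''⟩ ⟨A.restrictSolutionIso B P w.inv hw' hg' e'⟩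
  have h₂' : w.inv ≫ g' = g₂ := congrArg Subtype.val h₂
  rw [← h₂', w.hom_inv_id_assoc]

variable {A B P} in
/-- **The limit descent for every AFFINE test scheme over `Spec K`**: `∃!` classifying maps for rigidified
fibrewise-`Pic⁰` line bundles on `A_T`, `T` affine, from the same over affine `K`-schemes of finite type (every
affine `T → Spec K` is `Spec Γ(T, 𝒪_T)` with its induced `K`-algebra structure, Mathlib `Scheme.isoSpec`).
[cite: MumfordAV1970, §13 (proof of the Thm. p. 125)] [cite: StacksProject, Tag 01ZC and Tag 0B8W] [cite: GortzWedhorn2020, Thm. 10.57 and Thm. 10.60] -/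
theorem existsUnique_classify_affine_of_finiteType (hP : HasRank P 1)
    (hclosed : ∀ (T : Scheme.{u}) [IsAffine T] (f : T ⟶ Spec (.of K)) [LocallyOfFiniteType f]
      (ℒ : A.RigidifiedLineBundle f), IsClosed ℒ.picZeroLocus)
    (haff_ft : ∀ (T' : Scheme.{u}) [IsAffine T'] (f' : T' ⟶ Spec (.of K)) [LocallyOfFiniteType f']
      (ℒ' : A.RigidifiedLineBundle f'), ℒ'.FibrewisePicZero →
      ∃! g : {g : T' ⟶ B.X.left // g ≫ B.X.hom = f'},
        Nonempty ((Scheme.Modules.pullback (A.baseChangeToProd B f' g.1 g.2)).obj P ≅ ℒ'.L))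
    (T' : Scheme.{u}) [IsAffine T'] (f' : T' ⟶ Spec (.of K)) (ℒ' : A.RigidifiedLineBundle f')
    (hℒ' : ℒ'.FibrewisePicZero) :
    ∃! g : {g : T' ⟶ B.X.left // g ≫ B.X.hom = f'},
      Nonempty ((Scheme.Modules.pullback (A.baseChangeToProd B f' g.1 g.2)).obj P ≅ ℒ'.L) := by
  -- `T' = Spec R`, `R = Γ(T', 𝒪)` a `K`-algebra through `f'`
  let φ : K →+* Γ(T', ⊤) := ((Scheme.ΓSpecIso (.of K)).inv ≫ f'.appTop).hom
  letI : Algebra K Γ(T', ⊤) := φ.toAlgebra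
  have hw : T'.isoSpec.hom ≫ (specOver K Γ(T', ⊤)).hom = f' := by
    change T'.isoSpec.hom ≫ Spec.map (CommRingCat.ofHom φ) = f'
    rw [CommRingCat.ofHom_hom, Spec.map_comp, ← Category.assoc, Scheme.isoSpec_hom,
      ← Scheme.toSpecΓ_naturality, Category.assoc, toSpecΓ_SpecMap_ΓSpecIso_inv, Category.comp_id]
  exact existsUnique_classify_of_iso P T'.isoSpec hw
    (fun ℒ hℒ => existsUnique_classify_specOver hP hclosed haff_ft ℒ hℒ) ℒ' hℒ'

/-! ### §4 The M13 instance `A = A₀ ×_K Spec K`: the `Pic⁰` locus IS closed (★ B-p17 p717235) -/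

/-- **(0d) at the M13 instance, with NO closedness hypothesis**: for an abelian VARIETY `A₀/K` (abelian scheme
`A₀ ×_K Spec K` over `Spec K`), `∃!` classifying maps for rigidified fibrewise-`Pic⁰` line bundles over ALL affine
test schemes follow from the same over the affine test schemes of finite type — the `Pic⁰` locus over an affine
finite-type base is closed by ★ `isClosed_picZeroLocus` (B-p17 (g9), `AbelianVarieties/RigidifiedLineBundlePicZeroLocusClosed`).
[cite: MumfordAV1970, §13 (proof of the Thm. p. 125)] [cite: StacksProject, Tag 01ZC and Tag 0B8W] -/
theorem existsUnique_classify_affine_of_finiteType_ofAbelianVariety (A₀ : AbelianVariety K)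
    (B : AbelianSchemeOver (Spec (.of K))) (P : ((AbelianSchemeOver.ofAbelianVariety A₀).prodLeft B).Modules)
    (hP : HasRank P 1)
    (haff_ft : ∀ (T' : Scheme.{u}) [IsAffine T'] (f' : T' ⟶ Spec (.of K)) [LocallyOfFiniteType f']
      (ℒ' : (AbelianSchemeOver.ofAbelianVariety A₀).RigidifiedLineBundle f'), ℒ'.FibrewisePicZero →
      ∃! g : {g : T' ⟶ B.X.left // g ≫ B.X.hom = f'},
        Nonempty ((Scheme.Modules.pullback
          ((AbelianSchemeOver.ofAbelianVariety A₀).baseChangeToProd B f' g.1 g.2)).obj P ≅ ℒ'.L))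
    (T' : Scheme.{u}) [IsAffine T'] (f' : T' ⟶ Spec (.of K))
    (ℒ' : (AbelianSchemeOver.ofAbelianVariety A₀).RigidifiedLineBundle f') (hℒ' : ℒ'.FibrewisePicZero) :
    ∃! g : {g : T' ⟶ B.X.left // g ≫ B.X.hom = f'},
      Nonempty ((Scheme.Modules.pullback
        ((AbelianSchemeOver.ofAbelianVariety A₀).baseChangeToProd B f' g.1 g.2)).obj P ≅ ℒ'.L) :=
  existsUnique_classify_affine_of_finiteType hP (fun _ _ f _ ℒ => isClosed_picZeroLocus A₀ f ℒ) haff_ft T' f' ℒ' hℒ'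

end LimitDescent

end AbelianSchemeOver

end Literature.AlgebraicGeometry.AbelianSchemes
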